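import Summits.SmoothPoincare4.SmoothPoincare4.Theorems.ContractibleTwistedDoubleStandard.Negative.DoubleBisection
import Literature.Topology.FourManifolds.HCobordismIdealCircleProofs
import Literature.Topology.FourManifolds.BordismMerging
import Literature.Geometry.Symplectic.SteinBoundaryContactProofs
import Literature.Geometry.Manifold.CylinderSlice

/-!
# `ContractibleTwistedDoubleStandard` — negative-side support: load-bearing hypotheses

Which hypotheses of the crux
`Summit.SmoothPoincare4.SmoothPoincare4.Theses.ConvexBisection.ContractibleTwistedDoubleStandard`
(stmt-SmoothPoincare4-3546) carry weight, from the standing disprover's work file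
`Cruxes/ContractibleTwistedDoubleStandard/Disproof.lean` (§§1, 4); every variant statement is
written out inline (no new named `Prop`):

* `crux_iff_without_compactSpace` — `[CompactSpace X]` is REDUNDANT (the two compact images cover
  `X`, `compactSpace_of_cover`);
* `not_crux_without_contractible` — deleting the two `ContractibleSpace` hypotheses makes the
  statement FALSE; Lean witness: the empty bisection `X = W₁ = W₂ = ∅` (a junk instance — honest
  ones, e.g. `D(S¹ × D³) = S¹ × S³` or the doubles of Stein rational balls, are not yet constructible
  in the tree); so some nonemptiness-type hypothesis on the halves is indispensable;
* `not_crux_without_cover` — deleting the covering condition `range e₁ ∪ range e₂ = univ` makes it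
  FALSE with an honest witness: `X = S⁴ ⊔ S⁴` carrying the standard hemisphere bisection of the
  first summand (`Negative.DoubleBisection.crux_hypotheses_at_sphere` pushed along `Sum.inl`,
  `isSmoothEmbedding_inl_comp`); all other hypotheses hold with contractible halves, and
  `S⁴ ⊔ S⁴ ≄ S⁴` (`Literature.Geometry.Manifold.CylinderSlice.isEmpty_diffeomorph_twoSpheres`).
* Structural lemmas used on the way and useful to provers: `seam_mem_boundary` (seam points are
  boundary points of both halves), `seam_nonempty`, `connectedSpace_of_bisection`.
The Stein structures + contact matching cannot be deleted to a refutable statement: what remains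
("smooth twisted doubles of compact contractible 4-manifolds are `S⁴`") contains Gompf's Question
2.2 (arXiv:1603.05090, p. 8) and all presentation spheres — open.
-/

noncomputable section

open scoped Manifold ContDiff Topology
open Set Function Literature.Geometry.Symplectic Literature.Topology.FourManifolds

namespace Summit.SmoothPoincare4.SmoothPoincare4.Theorems.ContractibleTwistedDoubleStandard.Negative

open Summit.SmoothPoincare4.SmoothPoincare4.Theses.ConvexBisection

section Structure

variable {X : Type*} [TopologicalSpace X] [ChartedSpace (EuclideanSpace ℝ (Fin 4)) X]
  {W₁ : Type*} [TopologicalSpace W₁] [ChartedSpace (EuclideanHalfSpace 4) W₁]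
  {W₂ : Type*} [TopologicalSpace W₂] [ChartedSpace (EuclideanHalfSpace 4) W₂]
  {e₁ : W₁ → X} {e₂ : W₂ → X}

/-- **`X` is compact** as soon as it is covered by the images of two compact spaces under smooth
embeddings — so the crux's `[CompactSpace X]` is redundant. [folklore] -/
theorem compactSpace_of_cover [CompactSpace W₁] [CompactSpace W₂]
    (h₁ : Manifold.IsSmoothEmbedding (𝓡∂ 4) (𝓡 4) ∞ e₁)
    (h₂ : Manifold.IsSmoothEmbedding (𝓡∂ 4) (𝓡 4) ∞ e₂) (hcov : range e₁ ∪ range e₂ = univ) :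
    CompactSpace X := by
  refine ⟨?_⟩
  rw [← hcov]
  exact (isCompact_range h₁.isEmbedding.continuous).union
    (isCompact_range h₂.isEmbedding.continuous)

/-- **Seam points are boundary points** of both halves (from the two intersection conditions
and injectivity of the embeddings). [folklore] -/
theorem seam_mem_boundary (h₁ : Manifold.IsSmoothEmbedding (𝓡∂ 4) (𝓡 4) ∞ e₁)
    (h₂ : Manifold.IsSmoothEmbedding (𝓡∂ 4) (𝓡 4) ∞ e₂)
    (hL : range e₁ ∩ range e₂ = e₁ '' (𝓡∂ 4).boundary W₁)
    (hR : range e₁ ∩ range e₂ = e₂ '' (𝓡∂ 4).boundary W₂) {w₁ : W₁} {w₂ : W₂}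
    (hw : e₁ w₁ = e₂ w₂) : w₁ ∈ (𝓡∂ 4).boundary W₁ ∧ w₂ ∈ (𝓡∂ 4).boundary W₂ := by
  have hp : e₁ w₁ ∈ range e₁ ∩ range e₂ := ⟨mem_range_self _, hw ▸ mem_range_self _⟩
  constructor
  · rw [hL] at hp
    obtain ⟨w, hw', hww⟩ := hp
    rwa [← h₁.isEmbedding.injective hww]
  · rw [hR, hw] at hp
    obtain ⟨w, hw', hww⟩ := hp
    rwa [← h₂.isEmbedding.injective hww]

omit [TopologicalSpace X] [ChartedSpace (EuclideanSpace ℝ (Fin 4)) X] [TopologicalSpace W₂]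
  [ChartedSpace (EuclideanHalfSpace 4) W₂] in
/-- **The seam is nonempty** when the first half is a nonempty compact Stein domain (a Stein
domain has a boundary point, `SteinStructure.exists_isBoundaryPoint`). [folklore] -/
theorem seam_nonempty [IsManifold (𝓡∂ 4) ∞ W₁] [CompactSpace W₁] [Nonempty W₁]
    (J₁ : SteinStructure W₁) (hL : range e₁ ∩ range e₂ = e₁ '' (𝓡∂ 4).boundary W₁) :
    (range e₁ ∩ range e₂).Nonempty := by
  rw [hL]
  obtain ⟨x, hx⟩ := J₁.exists_isBoundaryPoint
  exact ⟨e₁ x, x, hx, rfl⟩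

/-- **`X` is connected** when it is covered by two connected halves meeting in a nonempty seam
(e.g. contractible Stein halves). [folklore] -/
theorem connectedSpace_of_bisection [ConnectedSpace W₁] [ConnectedSpace W₂]
    (h₁ : Manifold.IsSmoothEmbedding (𝓡∂ 4) (𝓡 4) ∞ e₁)
    (h₂ : Manifold.IsSmoothEmbedding (𝓡∂ 4) (𝓡 4) ∞ e₂) (hcov : range e₁ ∪ range e₂ = univ)
    (hne : (range e₁ ∩ range e₂).Nonempty) : ConnectedSpace X := by
  refine connectedSpace_iff_univ.2 ?_
  rw [← hcov]
  exact (isConnected_range h₁.isEmbedding.continuous).union hne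
    (isConnected_range h₂.isEmbedding.continuous)

end Structure

/-- **`[CompactSpace X]` is not load-bearing**: the crux is equivalent to its version without it.
[folklore] -/
theorem crux_iff_without_compactSpace : ContractibleTwistedDoubleStandard ↔
    ∀ (X : Type) [TopologicalSpace X] [T2Space X] [SecondCountableTopology X]
      [ChartedSpace (EuclideanSpace ℝ (Fin 4)) X] [IsManifold (𝓡 4) ∞ X]
      (W₁ : Type) [TopologicalSpace W₁] [ChartedSpace (EuclideanHalfSpace 4) W₁]
      [IsManifold (𝓡∂ 4) ∞ W₁] [CompactSpace W₁] [ContractibleSpace W₁]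
      (W₂ : Type) [TopologicalSpace W₂] [ChartedSpace (EuclideanHalfSpace 4) W₂]
      [IsManifold (𝓡∂ 4) ∞ W₂] [CompactSpace W₂] [ContractibleSpace W₂]
      (J₁ : SteinStructure W₁) (J₂ : SteinStructure W₂) (e₁ : W₁ → X) (e₂ : W₂ → X),
      Manifold.IsSmoothEmbedding (𝓡∂ 4) (𝓡 4) ∞ e₁ → Manifold.IsSmoothEmbedding (𝓡∂ 4) (𝓡 4) ∞ e₂ →
      range e₁ ∪ range e₂ = univ →
      range e₁ ∩ range e₂ = e₁ '' (𝓡∂ 4).boundary W₁ →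
      range e₁ ∩ range e₂ = e₂ '' (𝓡∂ 4).boundary W₂ →
      (∀ w₁ w₂, e₁ w₁ = e₂ w₂ →
        Submodule.map (mfderiv (𝓡∂ 4) (𝓡 4) e₁ w₁).toLinearMap (contactPlane J₁.J w₁) =
          Submodule.map (mfderiv (𝓡∂ 4) (𝓡 4) e₂ w₂).toLinearMap (contactPlane J₂.J w₂)) →
      Nonempty (X ≃ₘ⟮𝓡 4, 𝓡 4⟯ Metric.sphere (0 : EuclideanSpace ℝ (Fin 5)) 1) := by
  constructor
  · intro h X _ _ _ _ _ W₁ _ _ _ _ _ W₂ _ _ _ _ _ J₁ J₂ e₁ e₂ h1 h2 h3 h4 h5 h6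
    haveI := compactSpace_of_cover h1 h2 h3
    exact h X W₁ W₂ J₁ J₂ e₁ e₂ h1 h2 h3 h4 h5 h6
  · intro h X _ _ _ _ _ _ W₁ _ _ _ _ _ W₂ _ _ _ _ _ J₁ J₂ e₁ e₂ h1 h2 h3 h4 h5 h6
    exact h X W₁ W₂ J₁ J₂ e₁ e₂ h1 h2 h3 h4 h5 h6

/-- A map out of an empty charted space is a smooth embedding (vacuously an immersion, and an
embedding). [folklore] -/
theorem isSmoothEmbedding_of_isEmpty {E H M E' H' N : Type*} [NormedAddCommGroup E]
    [NormedSpace ℝ E] [TopologicalSpace H] {I : ModelWithCorners ℝ E H} [TopologicalSpace M]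
    [ChartedSpace H M] [NormedAddCommGroup E'] [NormedSpace ℝ E'] [TopologicalSpace H']
    {J : ModelWithCorners ℝ E' H'} [TopologicalSpace N] [ChartedSpace H' N] [IsEmpty M]
    (f : M → N) : Manifold.IsSmoothEmbedding I J ∞ f :=
  ⟨Manifold.IsImmersionOfComplement.isImmersion (F := Unit) fun x => isEmptyElim x,
    ⟨⟨by subsingleton⟩, fun x => isEmptyElim x⟩⟩

/-- **Contractibility is load-bearing**: with the two `ContractibleSpace` hypotheses deleted the
statement is false. Lean witness: the EMPTY bisection `X = W₁ = W₂ = ∅` — the empty type charted by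
the empty atlas over both models, with the vacuous Stein structure; every hypothesis holds and `∅`
is not diffeomorphic to the nonempty `S⁴`. (A junk witness: it certifies that some
nonemptiness-type hypothesis on the halves is needed, and `ContractibleSpace` is the only one the
crux has; honest witnesses such as `D(S¹ × D³) = S¹ × S³` are not yet constructible.) [folklore] -/
theorem not_crux_without_contractible : ¬
    ∀ (X : Type) [TopologicalSpace X] [T2Space X] [SecondCountableTopology X] [CompactSpace X]
      [ChartedSpace (EuclideanSpace ℝ (Fin 4)) X] [IsManifold (𝓡 4) ∞ X]
      (W₁ : Type) [TopologicalSpace W₁] [ChartedSpace (EuclideanHalfSpace 4) W₁]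
      [IsManifold (𝓡∂ 4) ∞ W₁] [CompactSpace W₁]
      (W₂ : Type) [TopologicalSpace W₂] [ChartedSpace (EuclideanHalfSpace 4) W₂]
      [IsManifold (𝓡∂ 4) ∞ W₂] [CompactSpace W₂]
      (J₁ : SteinStructure W₁) (J₂ : SteinStructure W₂) (e₁ : W₁ → X) (e₂ : W₂ → X),
      Manifold.IsSmoothEmbedding (𝓡∂ 4) (𝓡 4) ∞ e₁ → Manifold.IsSmoothEmbedding (𝓡∂ 4) (𝓡 4) ∞ e₂ →
      range e₁ ∪ range e₂ = univ →
      range e₁ ∩ range e₂ = e₁ '' (𝓡∂ 4).boundary W₁ →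
      range e₁ ∩ range e₂ = e₂ '' (𝓡∂ 4).boundary W₂ →
      (∀ w₁ w₂, e₁ w₁ = e₂ w₂ →
        Submodule.map (mfderiv (𝓡∂ 4) (𝓡 4) e₁ w₁).toLinearMap (contactPlane J₁.J w₁) =
          Submodule.map (mfderiv (𝓡∂ 4) (𝓡 4) e₂ w₂).toLinearMap (contactPlane J₂.J w₂)) →
      Nonempty (X ≃ₘ⟮𝓡 4, 𝓡 4⟯ Metric.sphere (0 : EuclideanSpace ℝ (Fin 5)) 1) := by
  intro h
  letI cX : ChartedSpace (EuclideanSpace ℝ (Fin 4)) Empty :=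
    { atlas := ∅
      chartAt := fun x => isEmptyElim x
      mem_chart_source := fun x => isEmptyElim x
      chart_mem_atlas := fun x => isEmptyElim x }
  letI cW : ChartedSpace (EuclideanHalfSpace 4) Empty :=
    { atlas := ∅
      chartAt := fun x => isEmptyElim x
      mem_chart_source := fun x => isEmptyElim x
      chart_mem_atlas := fun x => isEmptyElim x }
  haveI : IsManifold (𝓡 4) ∞ Empty :=
    isManifold_of_contDiffOn _ _ _ fun e e' he => absurd he (notMem_empty e)
  haveI : IsManifold (𝓡∂ 4) ∞ Empty :=
    isManifold_of_contDiffOn _ _ _ fun e e' he => absurd he (notMem_empty e)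
  let S : SteinStructure Empty :=
    { J := fun x => isEmptyElim x
      φ := fun x => isEmptyElim x
      J_sq := fun x => isEmptyElim x
      J_smooth := fun _ _ => fun x => isEmptyElim x
      integrable := fun _ _ _ _ x => isEmptyElim x
      φ_smooth := fun x => isEmptyElim x
      convex := fun x => isEmptyElim x
      boundary_eq := fun x => isEmptyElim x
      regular := fun x => isEmptyElim x }
  obtain ⟨Φ⟩ := h Empty Empty Empty S S id id (isSmoothEmbedding_of_isEmpty _)
    (isSmoothEmbedding_of_isEmpty _) (Subsingleton.elim _ _) (Subsingleton.elim _ _)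
    (Subsingleton.elim _ _) (fun w => isEmptyElim w)
  exact isEmptyElim (Φ.symm ⟨EuclideanSpace.single 0 1, by simp⟩)

/-- **Postcomposing a smooth embedding of a 4-manifold-with-boundary with `Sum.inl`** is a smooth
embedding into the disjoint union (immersions postcompose with the partial diffeomorphism
`Sum.inl`, `Manifold.IsImmersion.openPartialHomeomorph_comp`; Mathlib's `IsSmoothEmbedding.comp`
is still `proof_wanted`). [folklore] -/
theorem isSmoothEmbedding_inl_comp {X X' : Type*} [TopologicalSpace X]
    [ChartedSpace (EuclideanSpace ℝ (Fin 4)) X] [IsManifold (𝓡 4) ∞ X] [TopologicalSpace X']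
    [ChartedSpace (EuclideanSpace ℝ (Fin 4)) X'] [IsManifold (𝓡 4) ∞ X']
    {W : Type*} [TopologicalSpace W] [ChartedSpace (EuclideanHalfSpace 4) W]
    {e : W → X} (he : Manifold.IsSmoothEmbedding (𝓡∂ 4) (𝓡 4) ∞ e) :
    Manifold.IsSmoothEmbedding (𝓡∂ 4) (𝓡 4) ∞ (Sum.inl ∘ e : W → X ⊕ X') := by
  rcases isEmpty_or_nonempty X with hX | hX
  · haveI : IsEmpty W := ⟨fun w => hX.elim (e w)⟩
    exact isSmoothEmbedding_of_isEmpty _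
  have ho : Topology.IsOpenEmbedding (Sum.inl : X → X ⊕ X') := Topology.IsOpenEmbedding.inl
  have hinl : Manifold.IsSmoothEmbedding (𝓡 4) (𝓡 4) ∞ (Sum.inl : X → X ⊕ X') :=
    Manifold.IsSmoothEmbedding.sumInl
  have h1 : Manifold.IsImmersion (𝓡∂ 4) (𝓡 4) ∞ (ho.toOpenPartialHomeomorph Sum.inl ∘ e) :=
    he.isImmersion.openPartialHomeomorph_comp (ho.toOpenPartialHomeomorph Sum.inl)
      hinl.contMDiff.contMDiffOn
      (by
        rw [Topology.IsOpenEmbedding.toOpenPartialHomeomorph_target]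
        exact contMDiffOn_symm_of_isSmoothEmbedding hinl ho)
      (fun x => by simp)
  exact ⟨h1, Topology.IsEmbedding.inl.comp he.isEmbedding⟩

/-- **The covering condition is load-bearing**: with `range e₁ ∪ range e₂ = univ` deleted the
statement is false. Witness: `X = S⁴ ⊔ S⁴` with the standard hemisphere bisection of the first
summand (`crux_hypotheses_at_sphere` pushed along `Sum.inl`); every remaining hypothesis holds,
both halves are contractible (`contractibleSpace_closedBall_four`), and `S⁴ ⊔ S⁴ ≄ S⁴`
(`Literature.Geometry.Manifold.CylinderSlice.isEmpty_diffeomorph_twoSpheres`). (With the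
covering condition `X` is connected, `connectedSpace_of_bisection`.) [folklore] -/
theorem not_crux_without_cover : ¬
    ∀ (X : Type) [TopologicalSpace X] [T2Space X] [SecondCountableTopology X] [CompactSpace X]
      [ChartedSpace (EuclideanSpace ℝ (Fin 4)) X] [IsManifold (𝓡 4) ∞ X]
      (W₁ : Type) [TopologicalSpace W₁] [ChartedSpace (EuclideanHalfSpace 4) W₁]
      [IsManifold (𝓡∂ 4) ∞ W₁] [CompactSpace W₁] [ContractibleSpace W₁]
      (W₂ : Type) [TopologicalSpace W₂] [ChartedSpace (EuclideanHalfSpace 4) W₂]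
      [IsManifold (𝓡∂ 4) ∞ W₂] [CompactSpace W₂] [ContractibleSpace W₂]
      (J₁ : SteinStructure W₁) (J₂ : SteinStructure W₂) (e₁ : W₁ → X) (e₂ : W₂ → X),
      Manifold.IsSmoothEmbedding (𝓡∂ 4) (𝓡 4) ∞ e₁ → Manifold.IsSmoothEmbedding (𝓡∂ 4) (𝓡 4) ∞ e₂ →
      range e₁ ∩ range e₂ = e₁ '' (𝓡∂ 4).boundary W₁ →
      range e₁ ∩ range e₂ = e₂ '' (𝓡∂ 4).boundary W₂ →
      (∀ w₁ w₂, e₁ w₁ = e₂ w₂ →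
        Submodule.map (mfderiv (𝓡∂ 4) (𝓡 4) e₁ w₁).toLinearMap (contactPlane J₁.J w₁) =
          Submodule.map (mfderiv (𝓡∂ 4) (𝓡 4) e₂ w₂).toLinearMap (contactPlane J₂.J w₂)) →
      Nonempty (X ≃ₘ⟮𝓡 4, 𝓡 4⟯ Metric.sphere (0 : EuclideanSpace ℝ (Fin 5)) 1) := by
  intro h
  obtain ⟨e₁, e₂, hA, hB, -, hL, hR', hC⟩ := crux_hypotheses_at_sphere
  haveI := contractibleSpace_closedBall_four
  refine Literature.Geometry.Manifold.CylinderSlice.isEmpty_diffeomorph_twoSpheres.false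
    (Classical.choice (h (_ ⊕ _)
    (Metric.closedBall (0 : EuclideanSpace ℝ (Fin 4)) 1) (Metric.closedBall (0 : EuclideanSpace ℝ (Fin 4)) 1)
    steinStructureClosedBall steinStructureClosedBall (Sum.inl ∘ e₁) (Sum.inl ∘ e₂)
    (isSmoothEmbedding_inl_comp hA) (isSmoothEmbedding_inl_comp hB) ?_ ?_ ?_))
  · rw [range_comp, range_comp, ← image_inter Sum.inl_injective, hL, image_comp]
  · rw [range_comp, range_comp, ← image_inter Sum.inl_injective, hR', image_comp]
  · intro w₁ w₂ hw
    have hw' : e₁ w₁ = e₂ w₂ := Sum.inl_injective hw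
    have hc := hC w₁ w₂ hw'
    have hinl : MDifferentiableAt (𝓡 4) (𝓡 4)
        (Sum.inl : Metric.sphere (0 : EuclideanSpace ℝ (Fin 5)) 1 →
          Metric.sphere (0 : EuclideanSpace ℝ (Fin 5)) 1 ⊕ Metric.sphere (0 : EuclideanSpace ℝ (Fin 5)) 1)
        (e₁ w₁) :=
      (ContMDiff.inl (n := ∞)).mdifferentiableAt (by simp)
    have h1 : mfderiv (𝓡∂ 4) (𝓡 4)
        (Sum.inl ∘ e₁ : _ → Metric.sphere (0 : EuclideanSpace ℝ (Fin 5)) 1 ⊕ Metric.sphere (0 : EuclideanSpace ℝ (Fin 5)) 1) w₁ =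
        (mfderiv (𝓡 4) (𝓡 4) (Sum.inl : Metric.sphere (0 : EuclideanSpace ℝ (Fin 5)) 1 →
          Metric.sphere (0 : EuclideanSpace ℝ (Fin 5)) 1 ⊕ Metric.sphere (0 : EuclideanSpace ℝ (Fin 5)) 1) (e₁ w₁)).comp
          (mfderiv (𝓡∂ 4) (𝓡 4) e₁ w₁) :=
      mfderiv_comp w₁ hinl (hA.contMDiff.mdifferentiableAt (by simp))
    have h2 : mfderiv (𝓡∂ 4) (𝓡 4)
        (Sum.inl ∘ e₂ : _ → Metric.sphere (0 : EuclideanSpace ℝ (Fin 5)) 1 ⊕ Metric.sphere (0 : EuclideanSpace ℝ (Fin 5)) 1) w₂ =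
        (mfderiv (𝓡 4) (𝓡 4) (Sum.inl : Metric.sphere (0 : EuclideanSpace ℝ (Fin 5)) 1 →
          Metric.sphere (0 : EuclideanSpace ℝ (Fin 5)) 1 ⊕ Metric.sphere (0 : EuclideanSpace ℝ (Fin 5)) 1) (e₁ w₁)).comp
          (mfderiv (𝓡∂ 4) (𝓡 4) e₂ w₂) := by
      rw [hw'] at hinl ⊢
      exact mfderiv_comp w₂ hinl (hB.contMDiff.mdifferentiableAt (by simp))
    rw [h1, h2]
    have key := congrArg
      (Submodule.map (mfderiv (𝓡 4) (𝓡 4) (Sum.inl : Metric.sphere (0 : EuclideanSpace ℝ (Fin 5)) 1 →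
          Metric.sphere (0 : EuclideanSpace ℝ (Fin 5)) 1 ⊕ Metric.sphere (0 : EuclideanSpace ℝ (Fin 5)) 1)
        (e₁ w₁)).toLinearMap) hc
    exact ((Submodule.map_comp _ _ _).trans key).trans (Submodule.map_comp _ _ _).symm

end Summit.SmoothPoincare4.SmoothPoincare4.Theorems.ContractibleTwistedDoubleStandard.Negative
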